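import Summits.ValiantsHypothesis.ValiantsHypothesis.Theorems.DivisionGapZeroOneTransferProjClosureAux

/-!
# Crux `DivisionGap.PerCofactorDegreeReduction` (stmt-ValiantsHypothesis-15046), line `Sketch` —
# stub `stub_bottomComponentFree`: bottom weighted components are free for monotone circuits

**Theorem (`stub_bottomComponentFree`).** For a weight `w : σ → ℕ`, `p ∈ ℝ≥0[σ]` and `d : ℕ` with
`d ≤ weight_w m` for every monomial `m` of `p`: `L((p)_d) ≤ L(p)`, where
`(p)_d = weightedHomogeneousComponent w d p` and `L = complexity` is the tree's fan-in-two circuit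
size over the semiring `ℝ≥0`.  The skeleton (`Cruxes/PerCofactorDegreeReduction/Lines/Sketch.lean`,
`creationDegree_of_window`) uses it with `w = 1`: the bottom slice
`per_n · h♭ = (per_n · h)_{n + ord h}` is free, which settles the crux for every cofactor with a
monomial of small degree.

Proof.  The pruning argument (over `ℝ≥0` there is no cancellation, so every gate of a fan-in-two
circuit can be pruned to compute the bottom slice of its value: a sum gate keeps its effective
nonzero operands of minimal bottom weight, a product gate is unchanged; size and fan-in do not
grow) is ALREADY in the tree, as the mirror image of
`Theorems/ZeroOneTransfer/Negative/TopComponentFree.lean`: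
`Theorems/DivisionGapZeroOneTransferProjClosureAux.lean` proves
`ProjClosure.complexity_botComponent_le : L(botComponent w p) ≤ L(p)` with
`botComponent w p = (p)_{botDegree w p}`, `botDegree w p` the least `w`-weight of a monomial of `p`.
Under the hypothesis of the stub: if `p = 0` both sides concern `0`; if `d = botDegree w p` the
component is `botComponent w p`; otherwise `d < botDegree w p` (the bottom degree is attained,
`ProjClosure.exists_weight_eq_botDegree`), so no monomial of `p` has weight `d`, the component is
`0` (`weightedHomogeneousComponent_eq_zero'`) and `L(0) = 0` (`complexity_C_holds`).
Leans on the tree only; no definitions. [folklore]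
-/

noncomputable section

-- `Summit.ValiantsHypothesis.ValiantsHypothesis.…` is the tree's mandated single-conjunct layout
-- (Problem = Summit), so the duplicated namespace component is intended.
set_option linter.dupNamespace false

namespace Summit.ValiantsHypothesis.ValiantsHypothesis.Theorems.DivisionGap.PerCofactorDegreeReduction.BottomComponentFree

open MvPolynomial Literature.Computability.AlgebraicComplexity
open Summit.ValiantsHypothesis.ValiantsHypothesis.Theorems.DivisionGapZeroOneTransfer
open scoped NNReal

/-- `L(0) = 0` over `ℝ≥0` (the constant `0 = C 0` is a free input). [folklore] -/
theorem complexity_zero_nnreal {σ : Type*} : complexity (0 : MvPolynomial σ ℝ≥0) = 0 := by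
  simpa using complexity_C_holds (σ := σ) (0 : ℝ≥0)

/-- Under the hypothesis of the stub, a degree `d` other than the bottom degree of `p ≠ 0` carries
no monomial of `p`, so the `d`-component vanishes. [folklore] -/
theorem weightedHomogeneousComponent_eq_zero_of_ne_botDegree {σ : Type*} (w : σ → ℕ)
    {p : MvPolynomial σ ℝ≥0} {d : ℕ} (hp : p ≠ 0) (hd : ∀ m ∈ p.support, d ≤ Finsupp.weight w m)
    (hdb : d ≠ ProjClosure.botDegree w p) : weightedHomogeneousComponent w d p = 0 := by
  obtain ⟨m₀, hm₀, hm₀w⟩ := ProjClosure.exists_weight_eq_botDegree w hp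
  have hlt : d < ProjClosure.botDegree w p := lt_of_le_of_ne (hm₀w ▸ hd m₀ hm₀) hdb
  exact weightedHomogeneousComponent_eq_zero' d p fun m hm =>
    (hlt.trans_le (ProjClosure.botDegree_le w hm)).ne'

/-- **stub_bottomComponentFree — BOTTOM WEIGHTED COMPONENTS ARE FREE over `ℝ≥0`.**  If every
monomial of `p` has `w`-weight `≥ d` then the `w`-component of degree `d` of `p` (its bottom
slice, or `0`) costs no more than `p` in the tree's fan-in-two `complexity` over `ℝ≥0`: `p = 0`
is trivial; `d = botDegree w p` is `ProjClosure.complexity_botComponent_le`; otherwise the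
component is `0` and `L(0) = 0`. [folklore] -/
theorem stub_bottomComponentFree {σ : Type*} (w : σ → ℕ) (p : MvPolynomial σ ℝ≥0) (d : ℕ)
    (hd : ∀ m ∈ p.support, d ≤ Finsupp.weight w m) :
    complexity (weightedHomogeneousComponent w d p) ≤ complexity p := by
  by_cases hp : p = 0
  · subst hp
    rw [map_zero]
  by_cases hdb : d = ProjClosure.botDegree w p
  · subst hdb
    exact ProjClosure.complexity_botComponent_le w p
  · rw [weightedHomogeneousComponent_eq_zero_of_ne_botDegree w hp hd hdb, complexity_zero_nnreal]
    exact Nat.zero_le _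

end Summit.ValiantsHypothesis.ValiantsHypothesis.Theorems.DivisionGap.PerCofactorDegreeReduction.BottomComponentFree

end
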